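import Literature.AlgebraicGeometry.Frobenioids.NumberFieldLocalizationsFrobeniusSlim
import HarnessLib

/-!
# Frobenioids II, Proposition 1.5 (iv): the second bijection and the slimness converses, PROVED under
# the automorphism-lifting property of `E₀ → P₀` that the printed proof invokes

Mochizuki, *The geometry of Frobenioids II: poly-Frobenioids*, Kyushu J. Math. **62** (2008)
401–460, §1, Proposition 1.5 (iv), author's text p. 14 (kurims `paper:url-4322d76898e0`)
[cite: MochizukiFrdII2008, Prop. 1.5 (iv) p.14].  PROOF-ONLY companion (no definition, no named fact)
of `NumberFieldLocalizationsAut.lean` (abc-iut-L1-t8); sub-DAG W1 of plan/L1/DISCHARGE-L1.md §0, row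
P15-L04d of `SUBDAG-FrdII-Prop15.md` (seat abc-iut-w5-d174).

**Printed text and proof.** "(iv) … we have natural bijections `Aut(P_P → P) ⥲ Aut(E_E → P)`;
`Aut(E_E → E) ⥲ Aut(E_E → P)` … In particular, `P` is slim if and only if `E` is; `P` is Frobenius-slim
if and only if `E` is." — "Assertion (iv) follows immediately from the bijection of assertion (i) and the
bijection '`Aut_{E₀}(E₀) ⥲ Aut_{P₀}(P₀)`' observed in Example 1.4, (ii)" (p. 14 l.41–45).

**What this file settles (neutral record of the erratum candidate E2 of the typer).**  The SECOND
bijection and the converse directions "`E` slim ⇒ `P` slim", "`E` Frobenius-slim ⇒ `P` Frobenius-slim"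
are NOT valid for every `π : E₀ → P₀` with the other Example 1.4 (ii) properties — kernel witness
`NFLocCat.not_autWhiskerToP_surjective_perm_fin_three` (`NumberFieldLocalizationsAutWhiskerWitness.lean`,
`(G, D) = (S₃, A₃)`).  Here we prove that the printed INFERENCE is nevertheless correct: for an
abstract FAITHFUL `π : E₀ ⥤ P₀` with the AUTOMORPHISM-LIFTING property

  `∀ (Y : E₀) (a : π(Y) ≅ π(Y)), ∃ b : Y ≅ Y, π(b) = a`

(= the surjectivity half of the printed `Aut`-bijection of Example 1.4 (ii), taken as a HYPOTHESIS on
`π`; its injectivity half is faithfulness), the second map `Aut(E_E → E) → Aut(E_E → P)` IS bijective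
(`NFLoc.autWhiskerToP_bijective_of_autLifting`), and — adding essential surjectivity and the
reconstruction bijection of (i), as everywhere in Prop. 1.5 — "`E` slim ⇒ `P` slim"
(`NFLoc.isSlim_fst_of_isSlim`) and "`E` Frobenius-slim ⇒ `P` Frobenius-slim"
(`NFLoc.isFrobeniusSlim_fst_of_isFrobeniusSlim`) hold.  So erratum candidate E2 is LOCALISED to
Example 1.4 (ii)'s `Aut`-claim (typed as the named statement `NFLocCat.AutBijective G D`, refuted at
`(S₃, A₃)` by `NFLocCat.not_autBijective_perm_fin_three`): at the printed instance, Prop. 1.5 (iv) holds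
in full WHENEVER `AutBijective G D` does (`NFLocCat.prop15_iv_full_of_autBijective`).  Nothing here
decides for which `(G, D)` that is; no side is taken on how the printed sentences should be repaired.
Refereed pre-IUT material; nothing here bears on [IUTchIII] Cor. 3.12.
-/

namespace Literature.AlgebraicGeometry.Frobenioids

open CategoryTheory

universe v₀ v₁ v₂ u₀ u₁ u₂ v' u' u

namespace NFLoc

section FiberProduct

variable {P₀ : Type u₀} [Category.{v₀} P₀] {E₀ : Type u₁} [Category.{v₁} E₀]
  {P : Type u₂} [Category.{v₂} P] {F : P ⥤ P₀} {π : E₀ ⥤ P₀}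

/-- Lifting an isomorphism of `P`-components to `E = P ×_{P₀} E₀` along an automorphism-lifting `π`:
given objects `X, Y` of `E` with the SAME `E₀`-component and an isomorphism `g : X_P ≅ Y_P`, if the
induced automorphism `α_X⁻¹ ≫ F(g) ≫ α_Y` of `π(X_{E₀})` lifts to `E₀`, then `g` lifts to an isomorphism
of `E`.  (Used with `X = Y`.) [cite: MochizukiFrdII2008, Prop. 1.5 (iv) p.14] -/
theorem exists_iso_of_fst_iso (X : Loc F π) (g : X.fst ≅ X.fst)
    (hlift : ∃ b : X.snd ≅ X.snd, π.mapIso b = X.iso.symm ≪≫ F.mapIso g ≪≫ X.iso) :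
    ∃ φ : X ≅ X, φ.hom.fst = g.hom := by
  obtain ⟨b, hb⟩ := hlift
  have hb' : π.map b.hom = X.iso.inv ≫ F.map g.hom ≫ X.iso.hom := by
    simpa using congrArg Iso.hom hb
  let φ : X ⟶ X := ⟨g.hom, b.hom, by rw [hb', Iso.hom_inv_id_assoc]⟩
  haveI : IsIso φ.fst := (inferInstance : IsIso g.hom)
  haveI : IsIso φ.snd := (inferInstance : IsIso b.hom)
  haveI : IsIso φ := isIso_of_isIso_fst_snd φ
  exact ⟨asIso φ, rfl⟩

/-- **FrdII Prop. 1.5 (iv), SECOND bijection — surjectivity under automorphism-lifting (PROVED).**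
If `π : E₀ → P₀` is faithful and every automorphism of `π(Y)` lifts to an automorphism of `Y`
(`Y ∈ Ob(E₀)`; the surjectivity half of Example 1.4 (ii)'s printed `Aut`-bijection), then
`Aut(E_E → E) → Aut(E_E → P)` is surjective: a natural family of automorphisms of the `P`-components
lifts componentwise (by lifting) and the lifted family is natural (by faithfulness, a morphism of `E`
being determined by its `P`-component). [cite: MochizukiFrdII2008, Prop. 1.5 (iv) p.14] -/
theorem autWhiskerToP_surjective_of_autLifting [π.Faithful]
    (hlift : ∀ (Y : E₀) (a : π.obj Y ≅ π.obj Y), ∃ b : Y ≅ Y, π.mapIso b = a) (X : Loc F π) :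
    Function.Surjective (autWhiskerToP X) := by
  intro c
  -- lift each component
  have hcomp : ∀ U : Over X, ∃ φ : U.left ≅ U.left, φ.hom.fst = (c.app U).hom := fun U =>
    exists_iso_of_fst_iso U.left (c.app U) (hlift _ _)
  choose φ hφ using hcomp
  -- the lifted family is natural
  refine ⟨NatIso.ofComponents φ fun {U V} k => ?_, ?_⟩
  · apply hom_eq_of_fst_eq
    change k.left.fst ≫ (φ V).hom.fst = (φ U).hom.fst ≫ k.left.fst
    rw [hφ, hφ]
    exact c.hom.naturality k
  · refine Iso.ext (NatTrans.ext (funext fun U => ?_))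
    rw [autWhiskerToP_app]
    exact hφ U

/-- **FrdII Prop. 1.5 (iv), SECOND bijection `Aut(E_E → E) ⥲ Aut(E_E → P)` (PROVED under
automorphism-lifting):** for a faithful `π : E₀ → P₀` along which automorphisms lift, composition with
`E → P` is a bijection (injectivity: `autWhiskerToP_injective`, from faithfulness alone).
[cite: MochizukiFrdII2008, Prop. 1.5 (iv) p.14] -/
theorem autWhiskerToP_bijective_of_autLifting [π.Faithful]
    (hlift : ∀ (Y : E₀) (a : π.obj Y ≅ π.obj Y), ∃ b : Y ≅ Y, π.mapIso b = a) (X : Loc F π) :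
    Function.Bijective (autWhiskerToP X) :=
  ⟨autWhiskerToP_injective X, autWhiskerToP_surjective_of_autLifting hlift X⟩

/-- **FrdII Prop. 1.5 (iv), "`E` slim ⇒ `P` slim" (PROVED under automorphism-lifting):** for `π`
faithful, essentially surjective, with the reconstruction bijection of (i) and automorphism-lifting, if
`E = P ×_{P₀} E₀` is slim then so is `P`: a natural automorphism of `P_A → P` transports through the two
bijections of (iv) to one of `E_X → E` (`X` over `A`), which is trivial.
[cite: MochizukiFrdII2008, Prop. 1.5 (iv) p.14] -/
theorem isSlim_fst_of_isSlim [π.Faithful] [π.EssSurj] (h : HomReconstruction π)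
    (hlift : ∀ (Y : E₀) (a : π.obj Y ≅ π.obj Y), ∃ b : Y ≅ Y, π.mapIso b = a)
    (hE : IsSlim (Loc F π)) : IsSlim P := by
  refine ⟨fun A α => ?_⟩
  obtain ⟨X, rfl⟩ := exists_obj_over (F := F) (π := π) A
  obtain ⟨β, hβ⟩ := autWhiskerToP_surjective_of_autLifting hlift X (autPostToP X α)
  have hβ1 : β = Iso.refl _ := hE.isRigid_forget X β
  have h1 : autPostToP X α = 1 := by
    rw [← hβ, hβ1]
    exact map_one (autWhiskerToP X)
  have h2 : autPostToP X (Iso.refl _) = 1 := map_one _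
  exact autPostToP_injective h X (h1.trans h2.symm)

/-- **FrdII Prop. 1.5 (iv), "`E` Frobenius-slim ⇒ `P` Frobenius-slim" (PROVED under
automorphism-lifting):** with the same hypotheses, `Aut(P_A → P)` embeds into `Aut(E_X → E)` (`X` over
`A`) by the first bijection followed by the inverse of the second, so every `𝔽 → Aut(P_A → P)` factors
through `𝔽 ↠ N_{≥1}` as soon as every `𝔽 → Aut(E_X → E)` does ([FrdI] Def. 3.1 (i)).
[cite: MochizukiFrdII2008, Prop. 1.5 (iv) p.14] -/
theorem isFrobeniusSlim_fst_of_isFrobeniusSlim [π.Faithful] [π.EssSurj] (h : HomReconstruction π)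
    (hlift : ∀ (Y : E₀) (a : π.obj Y ≅ π.obj Y), ∃ b : Y ≅ Y, π.mapIso b = a)
    (hE : IsFrobeniusSlim (Loc F π)) : IsFrobeniusSlim P := by
  refine ⟨fun A f => ?_⟩
  obtain ⟨X, rfl⟩ := exists_obj_over (F := F) (π := π) A
  let e : Aut (Over.forget X) ≃* Aut (Over.forget X ⋙ toP F π) :=
    MulEquiv.ofBijective (autWhiskerToP X) (autWhiskerToP_bijective_of_autLifting hlift X)
  let ι : Aut (Over.forget X.fst) →* Aut (Over.forget X) := e.symm.toMonoidHom.comp (autPostToP X)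
  have hι : Function.Injective ι := e.symm.injective.comp (autPostToP_injective h X)
  exact hE.factors_of_injective X ι hι f

/-- **FrdII Prop. 1.5 (iv) IN FULL under automorphism-lifting** (abstract `π`): both printed bijections
and both printed equivalences "`P` slim ⇔ `E` slim", "`P` Frobenius-slim ⇔ `E` Frobenius-slim".
[cite: MochizukiFrdII2008, Prop. 1.5 (iv) p.14] -/
theorem prop15_iv_of_autLifting [π.Faithful] [π.EssSurj] (h : HomReconstruction π)
    (hlift : ∀ (Y : E₀) (a : π.obj Y ≅ π.obj Y), ∃ b : Y ≅ Y, π.mapIso b = a) :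
    (∀ X : Loc F π, Function.Bijective (autPostToP X)) ∧
      (∀ X : Loc F π, Function.Bijective (autWhiskerToP X)) ∧
      (IsSlim P ↔ IsSlim (Loc F π)) ∧ (IsFrobeniusSlim P ↔ IsFrobeniusSlim (Loc F π)) :=
  ⟨fun X => autPostToP_bijective h X, fun X => autWhiskerToP_bijective_of_autLifting hlift X,
    ⟨fun hP => isSlim_of_isSlim_fst h hP, fun hE => isSlim_fst_of_isSlim h hlift hE⟩,
    ⟨fun hP => isFrobeniusSlim_of_isFrobeniusSlim_fst h hP,
      fun hE => isFrobeniusSlim_fst_of_isFrobeniusSlim h hlift hE⟩⟩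

end FiberProduct

end NFLoc

/-! ### At Example 1.4's `E₀ → P₀`: Prop. 1.5 (iv) in full whenever the `Aut`-bijection of Ex. 1.4 (ii) holds -/

namespace NFLocCat

variable {G : Type u} [Group G] [TopologicalSpace G] [IsTopologicalGroup G] [CompactSpace G]
  [TotallyDisconnectedSpace G] (D : Subgroup G) {P : Type u'} [Category.{v'} P] (Φ : P ⥤ PCat G D)

/-- **FrdII Prop. 1.5 (iv) in full at the printed instance, conditional on Example 1.4 (ii)'s
`Aut`-bijection** (the typed named statement `NFLocCat.AutBijective G D`, whose surjectivity half is
exactly the automorphism-lifting property; `G` profinite): both bijections and both "if and only if"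
clauses for `E = P ×_{P₀} E₀`.  RECORDED (no side taken): `AutBijective G D` is refuted for
`(G, D) = (S₃, A₃)` (`not_autBijective_perm_fin_three`), where the conclusion also fails
(`not_autWhiskerToP_surjective_perm_fin_three`); this theorem localises the typer's erratum candidate E2
to Example 1.4 (ii). [cite: MochizukiFrdII2008, Prop. 1.5 (iv) p.14] -/
theorem prop15_iv_full_of_autBijective (hA : AutBijective G D) :
    (∀ X : NFLoc.Loc Φ (toP₀ G D), Function.Bijective (NFLoc.autPostToP X)) ∧
      (∀ X : NFLoc.Loc Φ (toP₀ G D), Function.Bijective (NFLoc.autWhiskerToP X)) ∧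
      (IsSlim P ↔ IsSlim (NFLoc.Loc Φ (toP₀ G D))) ∧
      (IsFrobeniusSlim P ↔ IsFrobeniusSlim (NFLoc.Loc Φ (toP₀ G D))) := by
  haveI : (toP₀ G D).Faithful := toP₀Faithful_holds D
  haveI : (toP₀ G D).EssSurj := toP₀EssSurj_of_profinite G D
  exact NFLoc.prop15_iv_of_autLifting (toP₀HomReconstruction_holds G D) fun Y a => (hA Y).2 a

end NFLocCat

end Literature.AlgebraicGeometry.Frobenioids
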